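import Mathlib.Analysis.Fourier.LpSpace
import Mathlib.Analysis.InnerProductSpace.PiL2
import Literature.Analysis.FunctionSpaces.FourierSobolevNorm
import Literature.Analysis.FunctionSpaces.Complexify
import HarnessLib

/-!
# Helical (spin-definite) sectors of a vector field on `ℝ³` and their `Ḣ^s` seminorms

Analysis/FluidPDE definitions file (definitions + algebraic sanity lemmas only: no named fact, no
regularity statement). Sources: F. Waleffe, *The nature of triad interactions in homogeneous
turbulence*, Phys. Fluids A 4 (1992) 350–363 [Waleffe1992] (helical-mode decomposition
`û(k) = u⁺(k) h₊(k) + u⁻(k) h₋(k)`, `i k × h_s = s|k| h_s`); P. Constantin, A. Majda, *The Beltrami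
spectrum for incompressible fluid flows*, Comm. Math. Phys. 115 (1988) 435–456; N. Lerner,
F. Vigneron, arXiv:2203.07950 [LernerVigneron2022] §1.2–§2 (the spectral projectors of `curl` restricted
to divergence-free fields: "`L²_div = (E₀ ⊗ ℂ³) ⊕ E₊ ⊕ E₋`, `E_± = {u ∈ 𝒱', Au = ±|D|u}`",
p. 8, (1.26)–(1.28); the critical sector energies `‖v_±‖²_{Ḣ^{1/2}}` and dissipations
`‖∇v_±‖²_{Ḣ^{1/2}}` of Prop. 14, p. 17); Z. Lei, F.-H. Lin, Y. Zhou, arXiv:1505.00142 [LeiLinZhou2015]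
(decomposition (1.5)–(1.6), `E_c(u_±)`).

On the Fourier side the orthogonal projection onto the spin-`σ` sector (`σ = ±1`) of a
divergence-free field is the multiplier `Q_σ(ξ) = ½ (1 + σ · i ξ̂ ×)` (`ξ̂ = ξ/‖ξ‖`): on amplitudes
`F ⊥ ξ` one has `(i ξ̂ ×)² F = F`, so `Q_±(ξ)` are the two complementary eigenprojections of
`i ξ̂ ×` (eigenvalues `±1`), i.e. of `curl` (symbol `2πi ξ ×` in Mathlib's normalisation — the
projections do not depend on the normalisation, only `ξ̂` enters). This file records

* `HelicalSector.icross ξ F = i ξ × F`, `HelicalSector.spinSymbol σ ξ F = ½ (F + (σ/‖ξ‖) i ξ × F)`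
  (`ξ = 0`: `½ F`, a null set), and the identity `spinSymbol 1 + spinSymbol (-1) = id`
  (`HelicalSector.spinSymbol_add`);
* `HelicalSector.fourierL2 v` — Mathlib's Plancherel `L²` Fourier transform
  (`MeasureTheory.Lp.fourierTransformₗᵢ`, notation `𝓕` on `Lp _ 2`) of the complexified field
  `EuclideanSpace.complexify ∘ v` (an a.e.-defined representative; junk `0` off `L²`), in the
  conventions of `Literature.Analysis.FunctionSpaces.FourierSobolevNorm`;
* `HelicalSector.eSeminormSq σ s v = ∫⁻ ‖ξ‖ₑ^{2s} ‖Q_σ(ξ) 𝓕v(ξ)‖ₑ² ∈ ℝ≥0∞` — the SQUARED `Ḣ^s`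
  seminorm of the spin-`σ` sector, in the units of `Function.eHomSobolevSeminorm` (so that, by
  pointwise orthogonality of the eigenspaces on transversal amplitudes,
  `eSeminormSq 1 s v + eSeminormSq (-1) s v = (Function.eHomSobolevSeminorm s (complexify ∘ v))²`
  for weakly divergence-free `v ∈ L²` — NOT proved here); **junk value `⊤` off `L²`**
  (by `simp [eSeminormSq, h]` either way: a genuine lower Lebesgue integral on `L²`, `⊤` off it);
* two time-dependent cell predicates used by regularity statements graded by one sector
  (LV22 Prop. 14's `h_σ`, `d_σ`): `HelicalSector.DissipationFiniteOn σ u T` — the sector has finite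
  `Ḣ^{3/2}`-dissipation on `(0,T)`, CERTIFIED BY A MEASURABLE INTEGRABLE MAJORANT (so that the lower
  integral in time of a possibly non-measurable `t ↦ d_σ(t)` carries no junk) — and
  `HelicalSector.CriticallyBoundedOn σ u T` — `sup_{[0,T)} ‖u^σ(t)‖²_{Ḣ^{1/2}} ≤ M` for a FINITE
  `M : ℝ≥0`.

Design: everything is a plain `def` over Mathlib + the tree's Fourier–Sobolev file; no `instance`,
no `notation`; no field is assumed divergence-free (on the longitudinal part `Q_σ` acts as `½`, which
is irrelevant for weakly divergence-free Leray–Hopf slices, whose transform is transversal a.e.).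
-/

noncomputable section

open MeasureTheory
open scoped ENNReal NNReal FourierTransform

namespace Literature.Analysis.FluidPDE.HelicalSector

open Literature.Analysis.FunctionSpaces
open Literature.Analysis.FunctionSpaces.EuclideanSpace (complexify)

/-- `i ξ × F` for a real frequency `ξ ∈ ℝ³` and a complex amplitude `F ∈ ℂ³` (componentwise cross
product times `i`): the symbol of `curl` up to Mathlib's factor `2π` (Waleffe 1992, eq. before (4):
`i k × h_s = s k h_s`). [cite: Waleffe1992, §II eq. (3)–(4)] -/
def icross (ξ : EuclideanSpace ℝ (Fin 3)) (F : EuclideanSpace ℂ (Fin 3)) : EuclideanSpace ℂ (Fin 3) :=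
  WithLp.toLp 2 ![Complex.I * ((ξ 1 : ℂ) * F 2 - (ξ 2 : ℂ) * F 1),
                  Complex.I * ((ξ 2 : ℂ) * F 0 - (ξ 0 : ℂ) * F 2),
                  Complex.I * ((ξ 0 : ℂ) * F 1 - (ξ 1 : ℂ) * F 0)]

/-- The spin-`σ` symbol `Q_σ(ξ) F = ½ (F + (σ/‖ξ‖) · i ξ × F)`: for `σ = ±1` and transversal `F`
(`ξ · F = 0`) the orthogonal projection onto the `±‖ξ‖`-eigenspace of `i ξ ×`, i.e. the Fourier
side of the projector onto `E_±` of Lerner–Vigneron (1.26)–(1.28); at `ξ = 0` (a null set) it is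
`½ F` by the `x/0 = 0` convention. [cite: LernerVigneron2022, §1.2 (1.26)–(1.28), p. 8] -/
def spinSymbol (σ : ℝ) (ξ : EuclideanSpace ℝ (Fin 3)) (F : EuclideanSpace ℂ (Fin 3)) :
    EuclideanSpace ℂ (Fin 3) :=
  (2 : ℂ)⁻¹ • (F + ((σ / ‖ξ‖ : ℝ) : ℂ) • icross ξ F)

/-- The `L²` Fourier transform of the complexified field `v : ℝ³ → ℝ³` (Mathlib's Plancherel
isometry `MeasureTheory.Lp.fourierTransformₗᵢ` on `L²`, as in
`Literature.Analysis.FunctionSpaces.eHomSobolevSeminorm`; an a.e.-defined representative).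
**Junk value:** `0` if `complexify ∘ v ∉ L²`. Non-Prop plumbing. [folklore] -/
def fourierL2 (v : EuclideanSpace ℝ (Fin 3) → EuclideanSpace ℝ (Fin 3)) :
    EuclideanSpace ℝ (Fin 3) → EuclideanSpace ℂ (Fin 3) :=
  open scoped Classical in
  if h : MemLp (complexify ∘ v) 2 (volume : Measure (EuclideanSpace ℝ (Fin 3))) then
    ((𝓕 (h.toLp (complexify ∘ v)) : Lp (EuclideanSpace ℂ (Fin 3)) 2
      (volume : Measure (EuclideanSpace ℝ (Fin 3)))) : EuclideanSpace ℝ (Fin 3) → EuclideanSpace ℂ (Fin 3))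
  else 0

/-- SQUARED `Ḣ^s` seminorm of the spin-`σ` sector of `v`:
`‖v^σ‖²_{Ḣ^s} = ∫ ‖ξ‖^{2s} ‖Q_σ(ξ) 𝓕v(ξ)‖² dξ ∈ ℝ≥0∞`, in the units of
`Function.eHomSobolevSeminorm` (Lerner–Vigneron Prop. 14: `‖v_±‖²_{Ḣ^{1/2}}`, `‖∇v_±‖²_{Ḣ^{1/2}}`;
Lei–Lin–Zhou (1.6): `E_c(u_±)`). **Junk value:** `⊤` if `complexify ∘ v ∉ L²`.
[cite: LernerVigneron2022, Prop. 14, p. 17] -/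
def eSeminormSq (σ s : ℝ) (v : EuclideanSpace ℝ (Fin 3) → EuclideanSpace ℝ (Fin 3)) : ℝ≥0∞ :=
  open scoped Classical in
  if MemLp (complexify ∘ v) 2 (volume : Measure (EuclideanSpace ℝ (Fin 3))) then
    ∫⁻ ξ, ‖ξ‖ₑ ^ (2 * s) * ‖spinSymbol σ ξ (fourierL2 v ξ)‖ₑ ^ 2
  else ⊤

/-- CELL PREDICATE — the spin-`σ` sector of the time-dependent field `u` has FINITE DISSIPATION on
`(0,T)`: `∫₀ᵀ ‖u^σ(t)‖²_{Ḣ^{3/2}} dt < ∞` (Lerner–Vigneron's `∫ d_σ`, Prop. 14), certified by a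
measurable integrable majorant `g` (so that the lower Lebesgue integral in time carries no junk for a
possibly non-measurable `t ↦ ‖u^σ(t)‖²_{Ḣ^{3/2}}`). [cite: LernerVigneron2022, Prop. 14, p. 17] -/
def DissipationFiniteOn (σ : ℝ)
    (u : ℝ → EuclideanSpace ℝ (Fin 3) → EuclideanSpace ℝ (Fin 3)) (T : ℝ) : Prop :=
  ∃ g : ℝ → ℝ≥0∞, Measurable g ∧ (∀ t ∈ Set.Ioo 0 T, eSeminormSq σ (3 / 2 : ℝ) (u t) ≤ g t) ∧
    (∫⁻ t in Set.Ioo 0 T, g t) < ⊤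

/-- CELL PREDICATE — the spin-`σ` sector of the time-dependent field `u` is CRITICALLY BOUNDED on
`[0,T)`: `sup_{0 ≤ t < T} ‖u^σ(t)‖²_{Ḣ^{1/2}} ≤ M` for a FINITE `M : ℝ≥0` (Lerner–Vigneron's
`sup h_σ`, Prop. 14 / Thm 9). [cite: LernerVigneron2022, Thm 9, p. 10] -/
def CriticallyBoundedOn (σ : ℝ)
    (u : ℝ → EuclideanSpace ℝ (Fin 3) → EuclideanSpace ℝ (Fin 3)) (T : ℝ) : Prop :=
  ∃ M : ℝ≥0, ∀ t ∈ Set.Ico 0 T, eSeminormSq σ (1 / 2 : ℝ) (u t) ≤ (M : ℝ≥0∞)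

/-! ### Sanity lemma -/

/-- `Q₊(ξ) + Q₋(ξ) = 1` on every amplitude: the two sectors recompose the field — the Fourier side of
Lerner–Vigneron's `ℙ = P₊ + P₋` on divergence-free fields ((1.28): `𝒱' = E₊ ⊕ E₋` modulo the
frequency-zero part) and of Waleffe's `û(k) = u⁺(k) h₊ + u⁻(k) h₋`; here as a pointwise identity valid on ALL
amplitudes. [cite: LernerVigneron2022, §1.2 (1.28), p. 8] -/
theorem spinSymbol_add (ξ : EuclideanSpace ℝ (Fin 3)) (F : EuclideanSpace ℂ (Fin 3)) :
    spinSymbol 1 ξ F + spinSymbol (-1) ξ F = F := by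
  ext i
  simp only [spinSymbol, PiLp.add_apply, PiLp.smul_apply, smul_eq_mul]
  push_cast
  ring

end Literature.Analysis.FluidPDE.HelicalSector
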